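import Summits.BirchSwinnertonDyer.BirchSwinnertonDyer.Theorems.KatoDescentPotSupersingularReducibleFineSelmerLevelZero
import Summits.BirchSwinnertonDyer.BirchSwinnertonDyer.Theorems.KatoDescentPotSupersingularSmallImageEulerSystemDivisibilityIrreducible
import HarnessLib

/-!
# Descent of a one-sided divisibility `char_Λ X₀(W/ℚ_∞) ∣ char_Λ(𝐇¹_Γ/Λs)` to the `Γ`-(co)invariants and to level 0,
# ROW-FREE: `#Sel₀(W/ℚ_∞)^Γ · #(desc. coker) ∣ #Sel₀(W/ℚ_∞)_Γ · [H¹(ℤ[1/p],T_pW) : ℤ_p s₀]` and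
# `#Sel₀(ℚ, W[p^∞]) · #(desc. coker) ∣ #W[p^∞]^{Γ_ℚ} · #Sel₀(W/ℚ_∞)_Γ · [H¹(ℤ[1/p],T_pW) : ℤ_p s₀]` from ANY source of
# the divisibility — with the irreducible small-image rows (Kato 13.4 + the K6 kernel μ-core) as the second instance

Seat `bsd-potss-rkm` g16 (prover; cell `bsd-potss`), item stmt-BirchSwinnertonDyer-19196 `ReducibleKatoMember` (crux M;
`--supports … --as helper`; closes nothing; ROUTE-FREE).  HONEST FRAMING: BSD is not proved by any of this; nothing is booked.

WHY.  The files `…ReducibleFineSelmerDescentCount[Sharp]` / `…ReducibleFineSelmerLevelZero` descend the Λ-adic divisibility of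
the REDUCIBLE rows (rkm g15: Kato 13.4 (2) off `p` + Wuthrich's `μ = 0` from FW + Lim 3.5).  The descent itself uses nothing
about the row: only (i) a dual fine Selmer datum `Y` with `Sel₀(W/ℚ_∞)[p]` finite (so `X₀` is finitely generated and torsion,
`μ`-free at `(p)`), (ii) a class `s ∈ 𝐇¹_Γ(T_pW)` with `proj₀ s` of infinite order on a rank-0 row (`W(ℚ)`, `Ш(W)[p^∞]` finite),
(iii) the divisibility `char_Λ(𝐇¹_Γ/Λs) ⊆ char_Λ X₀`.  This file states it in that generality (§1), so that every source of
(iii) plugs in: the reducible rows (recovering the sibling files), the IRREDUCIBLE NON-SURJECTIVE rows of the cell's U₀ items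
(§2: rkm g15's `charIdeal_le_charIdeal_fineSelmerDual_of_irreducible_of_not_surjective`, modulo {Kato 13.4, Serre} only, for a
`p`-indivisible genuine Euler-system class — items stmt-BirchSwinnertonDyer-19189 / 19197-children), and any future one
(big-image 13.4 (3); signed main-conjecture halves).

* §1 `natCard_fineSelmer_invariants_mul_descentCokernel_dvd_of_charIdeal_le` — (i)+(ii)+(iii) ⟹ `Sel₀(W/ℚ_∞)^Γ`, `Sel₀(W/ℚ_∞)_Γ`,
  the descent cokernel `H¹(ℤ[1/p],T_pW)/proj₀(𝐇¹_Γ/T)` and `H¹(ℤ[1/p],T_pW)/ℤ_p s₀` are finite and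
  `#Sel₀(W/ℚ_∞)^Γ · #(desc. coker) ∣ #Sel₀(W/ℚ_∞)_Γ · [H¹(ℤ[1/p],T_pW) : ℤ_p s₀]`;
  `natCard_fineSelmerZero_mul_descentCokernel_dvd_of_charIdeal_le` — and at level 0
  `#Sel₀(ℚ, W[p^∞]) · #(desc. coker) ∣ #W[p^∞]^{Γ_ℚ} · #Sel₀(W/ℚ_∞)_Γ · [H¹(ℤ[1/p],T_pW) : ℤ_p s₀]`.
* §2 `…_of_irreducible_of_not_surjective` — the instance on the irreducible non-surjective non-CM rows (`W` globally minimal,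
  `p ≠ 2`): for a genuine Euler-system class `s ∉ p·𝐇¹_Γ` with `proj₀ s` of infinite order, modulo {`thm13_4_…`, `serre_adicImage_…`}.

References: [Kato2004Asterisque] Thm. 13.4 (p. 226), Thm. 14.5 (3) (p. 236), §14.14 and Lemma 14.15 (pp. 243–244);
[GreenbergLNM1716] §4 Lemmas 4.2–4.3 (pp. 102–103); [SilvermanAEC2009] III.7.9 (a).
-/

-- the summit and its single problem are both named `BirchSwinnertonDyer` (registry layout D-0017)
set_option linter.dupNamespace false
set_option autoImplicit false

noncomputable section

open scoped NumberField
open Field IsDedekindDomain WeierstrassCurve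
open Literature.NumberTheory.GaloisRepresentations Literature.NumberTheory.EllipticCurves
open Literature.NumberTheory.EllipticCurves.GreenbergSelmer
open Literature.NumberTheory.EllipticCurves.Kato2004 Literature.NumberTheory.EllipticCurves.Kato2004.EulerSystemValues
open Literature.NumberTheory.EllipticCurves.IwasawaAlgebra Literature.NumberTheory.EllipticCurves.IwasawaDual

namespace Summit.BirchSwinnertonDyer.BirchSwinnertonDyer.Theorems.FineSelmerDescentOfDivisibility

/-! ## §1 Row-free descent of a divisibility -/

section RowFree

variable (W : WeierstrassCurve ℚ) [W.IsElliptic] (p : ℕ) [Fact p.Prime]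
  [ContinuousSMul ℤ_[p] (W.tateModule p)]
  [Finite W.toAffine.Point] [Finite (AddCommGroup.primaryComponent W.sha p)]
  {κ : ZpExtension ℚ p} {γ : absoluteGaloisGroup ℚ}

/-- **Descent of `char_Λ(𝐇¹_Γ/Λs) ⊆ char_Λ X₀` to the `Γ`-(co)invariants, row-free.**  For `W/ℚ` elliptic with `W(ℚ)` and
`Ш(W)[p^∞]` finite, the cyclotomic `(κ, γ)`, pinned `I`, a dual fine Selmer datum `Y` with `Sel₀(W/ℚ_∞)[p]` finite, and a class
`s ∈ 𝐇¹_Γ(T_pW)` with `proj₀ s` of infinite order and `char_Λ(𝐇¹_Γ/Λs) ⊆ char_Λ X₀(W/ℚ_∞)`: `Sel₀(W/ℚ_∞)^Γ`, `Sel₀(W/ℚ_∞)_Γ`,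
`H¹(ℤ[1/p],T_pW)/proj₀(𝐇¹_Γ/T)` and `H¹(ℤ[1/p],T_pW)/ℤ_p s₀` are finite and
**`#Sel₀(W/ℚ_∞)^Γ · #(H¹(ℤ[1/p],T_pW)/proj₀(𝐇¹_Γ/T)) ∣ #Sel₀(W/ℚ_∞)_Γ · [H¹(ℤ[1/p],T_pW) : ℤ_p s₀]`** — Kato's Thm. 14.5 (3)
`#𝐇²_Γ ≤ #𝐇²[T] · [𝐇¹_Γ/T : s̄]` read through `X₀`; UNCONDITIONAL given the displayed divisibility.
[cite: Kato2004Asterisque, Thm. 14.5 (3) (p. 236), §14.14 and Lemma 14.15 (pp. 243–244)] [cite: GreenbergLNM1716, §4 Lemma 4.2 (p. 102)] -/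
theorem natCard_fineSelmer_invariants_mul_descentCokernel_dvd_of_charIdeal_le (hκ : κ.IsCyclotomic)
    (hγ : κ.IsTopGenerator γ) (I : IwasawaH1Data W p κ γ) (Y : W.FineSelmerDualData κ γ)
    (hfinp : Set.Finite {t : W.fineSelmerInfty κ | p • t = 0}) (s : I.H) (hnt : ¬ IsOfFinAddOrder (I.proj 0 s))
    (hchar : Module.charIdeal (IwasawaAlgebra p) (I.H ⧸ Submodule.span (IwasawaAlgebra p) {s}) ≤
      Module.charIdeal (IwasawaAlgebra p) Y.X) :
    Finite (endInvariants (W.conjFineSelmerInfty κ γ - 1)) ∧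
      Finite (EndCoinvariants (W.conjFineSelmerInfty κ γ - 1)) ∧ Finite I.descentCokernel ∧
      Finite (integralH1 (tateRep W p) p (κ.layerSubgroup 0) ⧸
        Submodule.span ℤ_[p] {(⟨I.proj 0 s, I.proj_mem 0 s⟩ : integralH1 (tateRep W p) p (κ.layerSubgroup 0))}) ∧
      Nat.card (endInvariants (W.conjFineSelmerInfty κ γ - 1)) * Nat.card I.descentCokernel ∣
        Nat.card (EndCoinvariants (W.conjFineSelmerInfty κ γ - 1)) *
          Nat.card (integralH1 (tateRep W p) p (κ.layerSubgroup 0) ⧸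
            Submodule.span ℤ_[p] {(⟨I.proj 0 s, I.proj_mem 0 s⟩ :
              integralH1 (tateRep W p) p (κ.layerSubgroup 0))}) := by
  have hs0 : s ≠ 0 := by
    rintro rfl
    exact hnt (by rw [map_zero]; exact isOfFinAddOrder_iff_nsmul_eq_zero.mpr ⟨1, one_pos, by simp⟩)
  haveI : Module.Finite (IwasawaAlgebra p) I.H := IwasawaH1Data.module_finite_of_isCyclotomic hκ hγ I
  haveI := I.noZeroSMulDivisors hγ
  have htors : Module.IsTorsion (IwasawaAlgebra p) (I.H ⧸ Submodule.span (IwasawaAlgebra p) {s}) :=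
    ReducibleZetaDivisibility.isTorsion_quotient_span_singleton_of_ne_zero W p hκ hγ I hs0
  haveI : Module.Finite (IwasawaAlgebra p) Y.X := Y.module_finite_of_finite_pTorsion hγ hfinp
  haveI : Finite (Y.X ⧸ (IwasawaAlgebra.augIdealP p • (⊤ : Submodule (IwasawaAlgebra p) Y.X))) :=
    Y.finite_quotient_augIdealP_of_finite_pTorsion hfinp
  have hYtors : Module.IsTorsion (IwasawaAlgebra p) Y.X :=
    IwasawaModuleFinitePadicInt.isTorsion_of_finite_quotient_augIdealP p Y.X inferInstance
  -- finiteness of `N/TN`, `N = 𝐇¹_Γ/Λs` (the pin, (R0))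
  obtain ⟨-, hfinN⟩ := ReducibleFineSelmerDescentCount.finite_coinvariants_quotient_span_of_not_isOfFinAddOrder hκ hγ I s hnt
  -- the Γ-Euler-characteristic descent
  obtain ⟨hiM, hcM, hiN⟩ := finite_coinvariants_of_charIdeal_le hYtors htors hchar hfinN
  have hdvd := natCard_coinvariants_mul_dvd_of_charIdeal_le hYtors htors hchar hfinN
  rw [Kato2004.natCard_invariants_quotient_span_eq_one s hs0 hiN, mul_one,
    Kato2004.natCard_coinvariants_quotient_span s] at hdvd
  have hD := Y.isDualPair hγ
  refine ⟨hD.finite_coinvariants_iff.mp hcM, hD.finite_invariants_iff.mp hiM,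
    ReducibleFineSelmerDescentCount.finite_descentCokernel_of_not_isOfFinAddOrder hκ hγ I s hnt,
    ReducibleFineSelmerDescentCount.finite_quotient_span_of_not_isOfFinAddOrder I s hnt, ?_⟩
  rw [hD.natCard_coinvariants, hD.natCard_invariants] at hdvd
  rw [ReducibleFineSelmerDescentCount.natCard_quotient_span_eq_natCard_descentCokernel_mul hκ hγ I s,
    mul_left_comm _ (Nat.card I.descentCokernel), mul_comm _ (Nat.card I.descentCokernel)]
  exact mul_dvd_mul_left _ hdvd

/-- **The same at LEVEL 0, row-free**: under the hypotheses of
`natCard_fineSelmer_invariants_mul_descentCokernel_dvd_of_charIdeal_le`,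
`#Sel₀(ℚ, W[p^∞]) · #(H¹(ℤ[1/p],T_pW)/proj₀(𝐇¹_Γ/T)) ∣ #W[p^∞]^{Γ_ℚ} · #Sel₀(W/ℚ_∞)_Γ · [H¹(ℤ[1/p],T_pW) : ℤ_p s₀]`
(level-0 fine Selmer group = Greenberg's strict Selmer group of the fine data over `Γ_ℚ`; kernel of restriction of order
`#W[p^∞]^{Γ_ℚ}`, `ReducibleFineSelmerLevelZero.natCard_fineSelmerZero_dvd_rat`).
[cite: Kato2004Asterisque, Thm. 14.5 (3) (p. 236), §14.14 (pp. 243–244)] [cite: GreenbergLNM1716, §4 Lemmas 4.2–4.3 (pp. 102–103)] -/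
theorem natCard_fineSelmerZero_mul_descentCokernel_dvd_of_charIdeal_le (hκ : κ.IsCyclotomic)
    (hγ : κ.IsTopGenerator γ) (I : IwasawaH1Data W p κ γ) (Y : W.FineSelmerDualData κ γ)
    (hfinp : Set.Finite {t : W.fineSelmerInfty κ | p • t = 0}) (s : I.H) (hnt : ¬ IsOfFinAddOrder (I.proj 0 s))
    (hchar : Module.charIdeal (IwasawaAlgebra p) (I.H ⧸ Submodule.span (IwasawaAlgebra p) {s}) ≤
      Module.charIdeal (IwasawaAlgebra p) Y.X) :
    Nat.card (strictSelmerGroupOver (κ.layerSubgroup 0) (W.geomPrimaryTorsion p) p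
        (fineData (W.geomPrimaryTorsion p) p)) * Nat.card I.descentCokernel ∣
      Nat.card {m : W.geomPrimaryTorsion p | ∀ σ : absoluteGaloisGroup ℚ, σ • m = m} *
        Nat.card (EndCoinvariants (W.conjFineSelmerInfty κ γ - 1)) *
          Nat.card (integralH1 (tateRep W p) p (κ.layerSubgroup 0) ⧸
            Submodule.span ℤ_[p] {(⟨I.proj 0 s, I.proj_mem 0 s⟩ :
              integralH1 (tateRep W p) p (κ.layerSubgroup 0))}) := by
  have h1 := ReducibleFineSelmerLevelZero.natCard_fineSelmerZero_dvd_rat W κ γ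
  rw [ReducibleFineSelmerLevelZero.setOf_fixed_layerZero_eq W p κ] at h1
  obtain ⟨-, -, -, -, h2⟩ := natCard_fineSelmer_invariants_mul_descentCokernel_dvd_of_charIdeal_le W p hκ hγ I Y
    hfinp s hnt hchar
  refine (mul_dvd_mul_right h1 _).trans ?_
  rw [mul_assoc, mul_assoc]
  exact mul_dvd_mul_left _ h2

end RowFree

/-! ## §2 Instance: the irreducible non-surjective non-CM rows (U₀-ns), modulo {Kato 13.4, Serre} -/

section Irreducible

variable (W : WeierstrassCurve ℚ) [W.IsElliptic] [W.IsGloballyMinimal] (p : ℕ) [Fact p.Prime]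
  [ContinuousSMul ℤ_[p] (W.tateModule p)] [Module.Free ℤ_[p] (W.tateModule p)]
  [Module.Finite ℤ_[p] (W.tateModule p)]
  [Finite W.toAffine.Point] [Finite (AddCommGroup.primaryComponent W.sha p)]
  {κ : ZpExtension ℚ p} {γ : absoluteGaloisGroup ℚ}

/-- **Kato Thm. 14.5 (3) on the fine road, `Γ`-level and level 0, on the IRREDUCIBLE NON-SURJECTIVE non-CM rank-0 rows.**
For `W/ℚ` globally minimal, non-CM, `p ≠ 2`, `E[p]` irreducible with `ρ̄_{W,p}` NOT onto, `W(ℚ)` and `Ш(W)[p^∞]` finite, the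
cyclotomic `(κ, γ)`, pinned `I`, any `Y`, and a genuine Λ-adic Euler-system class `s ∉ p·𝐇¹_Γ(T_pW)` with `proj₀ s` of
infinite order: the conclusions of §1 hold — in particular
`#Sel₀(W/ℚ_∞)^Γ · #(H¹(ℤ[1/p],T_pW)/proj₀(𝐇¹_Γ/T)) ∣ #Sel₀(W/ℚ_∞)_Γ · [H¹(ℤ[1/p],T_pW) : ℤ_p s₀]` and
`#Sel₀(ℚ, W[p^∞]) · #(H¹(ℤ[1/p],T_pW)/proj₀(𝐇¹_Γ/T)) ∣ #W[p^∞]^{Γ_ℚ} · #Sel₀(W/ℚ_∞)_Γ · [H¹(ℤ[1/p],T_pW) : ℤ_p s₀]` — modulo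
{`thm13_4_…`, `serre_adicImage_…`} only (`Sel₀(W/ℚ_∞)[p]` finite from the tree's K6 kernel μ-core
`CoreAssembly.coreOdd_anyReduction_holds`; divisibility rkm g15 `charIdeal_le_charIdeal_fineSelmerDual_of_irreducible_of_not_surjective`).
[cite: Kato2004Asterisque, Thm. 13.4 (2) (p. 226), Thm. 14.5 (3) (p. 236), §14.14 (pp. 243–244)] [cite: SilvermanAEC2009, Thm. III.7.9 (a)]
[cite: GreenbergLNM1716, §4 Lemmas 4.2–4.3 (pp. 102–103)] -/
theorem natCard_fineSelmer_mul_descentCokernel_dvd_of_irreducible_of_not_surjective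
    (h134 : thm13_4_lengthAt_fineSelmerDual_le_of_isEulerSystemClass)
    (hSerre : serre_adicImage_contains_congruenceSubgroup)
    (hp : p ≠ 2) (hκ : κ.IsCyclotomic) (hγ : κ.IsTopGenerator γ) (hCM : ¬ W.HasCM)
    (hirr : W.HasIrreducibleModPGaloisRep p) (hns : ¬ W.HasSurjectiveModNGaloisRep (p : ℤ))
    (I : IwasawaH1Data W p κ γ) (Y : W.FineSelmerDualData κ γ) (s : I.H) (hs : IsEulerSystemClass W p κ γ I s)
    (hsp : s ∉ IwasawaAlgebra.augIdealP p • (⊤ : Submodule (IwasawaAlgebra p) I.H))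
    (hnt : ¬ IsOfFinAddOrder (I.proj 0 s)) :
    (Nat.card (endInvariants (W.conjFineSelmerInfty κ γ - 1)) * Nat.card I.descentCokernel ∣
        Nat.card (EndCoinvariants (W.conjFineSelmerInfty κ γ - 1)) *
          Nat.card (integralH1 (tateRep W p) p (κ.layerSubgroup 0) ⧸
            Submodule.span ℤ_[p] {(⟨I.proj 0 s, I.proj_mem 0 s⟩ :
              integralH1 (tateRep W p) p (κ.layerSubgroup 0))})) ∧
      Nat.card (strictSelmerGroupOver (κ.layerSubgroup 0) (W.geomPrimaryTorsion p) p
          (fineData (W.geomPrimaryTorsion p) p)) * Nat.card I.descentCokernel ∣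
        Nat.card {m : W.geomPrimaryTorsion p | ∀ σ : absoluteGaloisGroup ℚ, σ • m = m} *
          Nat.card (EndCoinvariants (W.conjFineSelmerInfty κ γ - 1)) *
            Nat.card (integralH1 (tateRep W p) p (κ.layerSubgroup 0) ⧸
              Submodule.span ℤ_[p] {(⟨I.proj 0 s, I.proj_mem 0 s⟩ :
                integralH1 (tateRep W p) p (κ.layerSubgroup 0))}) := by
  have hs0 : s ≠ 0 := by
    rintro rfl
    exact hsp (Submodule.zero_mem _)
  haveI : Module.Finite (IwasawaAlgebra p) I.H := IwasawaH1Data.module_finite_of_isCyclotomic hκ hγ I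
  haveI := I.noZeroSMulDivisors hγ
  have htors : Module.IsTorsion (IwasawaAlgebra p) (I.H ⧸ Submodule.span (IwasawaAlgebra p) {s}) :=
    ReducibleZetaDivisibility.isTorsion_quotient_span_singleton_of_ne_zero W p hκ hγ I hs0
  -- `Sel₀(W/ℚ_∞)[p]` finite from the kernel μ-core on the irreducible non-surjective row
  obtain ⟨J, hJ⟩ := Rank1Residual.CoreAssembly.coreOdd_anyReduction_holds W p κ γ I hp hirr hns hκ hγ ⟨s, hs, hsp⟩
  have hfinp := W.finite_fineSelmerInfty_pTorsion_of_forall_iterate_eq_zero κ hγ hJ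
  have hchar := SmallImageEulerSystemBoundOffP.charIdeal_le_charIdeal_fineSelmerDual_of_irreducible_of_not_surjective h134
    hSerre W p κ γ hp hκ hγ hCM hirr hns I Y s hs hsp htors
  exact ⟨(natCard_fineSelmer_invariants_mul_descentCokernel_dvd_of_charIdeal_le W p hκ hγ I Y hfinp s hnt hchar).2.2.2.2,
    natCard_fineSelmerZero_mul_descentCokernel_dvd_of_charIdeal_le W p hκ hγ I Y hfinp s hnt hchar⟩

end Irreducible

end Summit.BirchSwinnertonDyer.BirchSwinnertonDyer.Theorems.FineSelmerDescentOfDivisibility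

end
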